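import Mathlib

/-!
# The Galois-equivariant eigenbasis of `K ⊗[F₀] V` for a `K`-vector space `V` — LEMMA-R-RESIDUE.md §5's
«`e_{(j,x)} := (ε_x ⊗ 1)(ω_j)`» on the kernel

Blind re-derivation cell `pub-hodge-repro`, seat `t3-p4` (Tier 3, T3.5 for T3.4).  Target tree path
`lean/Summits/Ventures/HodgeRepro/Tier3EigenBasis.lean`; Mathlib only.

LEMMA-R-RESIDUE.md v5 §5 chooses, for `B_red = ∏_j A_j` with `H¹(A_j, ℚ)` free of rank one over the Galois CM field
`F` (generator `ω_j`), an `F`-basis `{e_{(j,x)}}_{(j,x) ∈ J × Gal(F/ℚ)}` of `H¹(B_red, ℚ) ⊗_ℚ F` such that `e_{(j,x)}` spans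
the `x`-eigenline of the `F`-action on the `j`-th factor and `(τ ⊗ 1) e_{(j,x)} = e_{(j, τ∘x)}` — «the normalisation of
Deligne's decomposition (LNM 900 p0030:L23–36) by a rational generator».  This file constructs that basis for an
arbitrary finite Galois extension `K/F₀` and an arbitrary `K`-vector space `V` with `K`-basis `ω : J → V`: with `k` a
basis of `K/F₀` and `k^*` its trace-dual basis,

  `e (j, x) := Σ_l x(k^*_l) ⊗ (k_l • ω_j) ∈ K ⊗[F₀] V`   (written out in every statement; no definition is introduced —
  the theorem names carry the suffix `eigenVec` for this family)

satisfies (1) `(σ ⊗ 1) e (j, x) = e (j, σ * x)` (`rTensor_eigenVec`), (2) `(1 ⊗ b) e (j, x) = x(b) • e (j, x)` for the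
`K`-action of `V` (`lTensor_lsmul_eigenVec`; the trace-dual expansion `y = Σ_l Tr(y k_l) k^*_l`), (3) the family is
`K`-linearly independent (`linearIndependent_eigenVec`: Dedekind's independence of characters,
`linearIndependent_monoidHom`), hence (4) a `K`-basis of `K ⊗[F₀] V` by counting (`|J × Gal(K/F₀)| = |J|·[K:F₀]`,
`IsGalois.card_aut_eq_finrank`) — `exists_equivariant_eigenbasis`.

HONESTY.  Linear algebra on Mathlib; the passage from `H¹` to the wedges `H^{2p} = ∧^{2p} H¹` (coordinate wedges of
an equivariant basis form an equivariant basis) and everything geometric stay on paper.  HC_CM is NOT proved by anyone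
in this repository.
-/

set_option autoImplicit false

open TensorProduct

namespace HodgeRepro.Tier3

variable {F₀ K : Type*} [Field F₀] [Field K] [Algebra F₀ K]
variable {V : Type*} [AddCommGroup V] [Module K V] [Module F₀ V] [IsScalarTower F₀ K V]
variable {ι J : Type*} [Fintype ι] [DecidableEq ι]
variable [FiniteDimensional F₀ K] [Algebra.IsSeparable F₀ K]

omit [IsScalarTower F₀ K V] in
/-- `σ ⊗ 1` carries the vector `Σ_l x(k^*_l) ⊗ (k_l • ω_j)` to the one with `σ * x` in place of `x`. -/
theorem rTensor_eigenVec (k : Module.Basis ι F₀ K) (ω : J → V) (σ x : K ≃ₐ[F₀] K) (j : J) :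
    LinearMap.rTensor V σ.toLinearMap (∑ l, x (k.traceDual l) ⊗ₜ[F₀] (k l • ω j)) =
      ∑ l, (σ * x) (k.traceDual l) ⊗ₜ[F₀] (k l • ω j) := by
  simp only [map_sum, LinearMap.rTensor_tmul, AlgEquiv.toLinearMap_apply, AlgEquiv.mul_apply]

/-- Coordinates in a basis `k` of `K/F₀` are traces against the trace-dual basis: `k.repr y l = Tr(y · k^*_l)`. -/
theorem basis_repr_eq_trace_mul_traceDual (k : Module.Basis ι F₀ K) (y : K) (l : ι) :
    k.repr y l = Algebra.trace F₀ K (y * k.traceDual l) := by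
  conv_lhs => rw [← k.traceDual_traceDual]
  rw [Module.Basis.traceDual_repr_apply, Algebra.traceForm_apply]

/-- `(1 ⊗ b)` acts on `Σ_l x(k^*_l) ⊗ (k_l • ω_j)` by the scalar `x(b)`: the vector is an eigenvector of the
`K`-action of `V` with eigen-character `x`. -/
theorem lTensor_lsmul_eigenVec (k : Module.Basis ι F₀ K) (ω : J → V) (x : K ≃ₐ[F₀] K) (j : J) (b : K) :
    LinearMap.lTensor K ((LinearMap.lsmul K V b).restrictScalars F₀)
        (∑ l, x (k.traceDual l) ⊗ₜ[F₀] (k l • ω j)) =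
      x b • ∑ l, x (k.traceDual l) ⊗ₜ[F₀] (k l • ω j) := by
  simp only [map_sum, LinearMap.lTensor_tmul, LinearMap.restrictScalars_apply, LinearMap.lsmul_apply,
    Finset.smul_sum]
  -- expand `b * k l` in the basis `k`: `b * k l = Σ_m Tr(b k_l k^*_m) k_m`
  have hexp : ∀ l, b • k l • ω j = ∑ m, Algebra.trace F₀ K (b * k l * k.traceDual m) • (k m • ω j) := by
    intro l
    rw [smul_smul]
    conv_lhs => rw [← k.sum_repr (b * k l)]
    rw [Finset.sum_smul]
    refine Finset.sum_congr rfl fun m _ => ?_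
    rw [basis_repr_eq_trace_mul_traceDual, smul_assoc]
  simp only [hexp, TensorProduct.tmul_sum, TensorProduct.tmul_smul]
  rw [Finset.sum_comm]
  refine Finset.sum_congr rfl fun m _ => ?_
  -- `Σ_l Tr(b k_l k^*_m) • (x(k^*_l) ⊗ w) = x(b k^*_m) ⊗ w = x b • (x(k^*_m) ⊗ w)`
  simp only [TensorProduct.smul_tmul', ← TensorProduct.sum_tmul, smul_eq_mul, ← map_mul]
  congr 1
  have hdual : b * k.traceDual m = ∑ l, Algebra.trace F₀ K (b * k.traceDual m * k l) • k.traceDual l := by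
    conv_lhs => rw [← k.traceDual.sum_repr (b * k.traceDual m)]
    refine Finset.sum_congr rfl fun l _ => ?_
    rw [Module.Basis.traceDual_repr_apply, Algebra.traceForm_apply]
  rw [hdual, map_sum]
  refine Finset.sum_congr rfl fun l _ => ?_
  rw [map_smul, Algebra.smul_def, Algebra.smul_def, mul_right_comm b (k l) (k.traceDual m)]

omit [FiniteDimensional F₀ K] [Algebra.IsSeparable F₀ K] in
/-- Dedekind's independence of characters for the Galois group: the automorphisms `x ∈ Gal(K/F₀)`, as `K`-valued
functions on `K`, are `K`-linearly independent (Mathlib `linearIndependent_monoidHom`). -/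
theorem linearIndependent_algEquiv_coe :
    LinearIndependent K (fun x : K ≃ₐ[F₀] K => (x : K → K)) := by
  have hinj : Function.Injective (fun x : K ≃ₐ[F₀] K => (x : K →* K)) := by
    intro x y hxy
    ext a
    have := congrArg (fun f : K →* K => f a) hxy
    simpa using this
  exact (linearIndependent_monoidHom K K).comp _ hinj

/-- The expansion of `Σ_p g_p • e_p` in the `K`-basis `1 ⊗ (k_l • ω_j)` of `K ⊗[F₀] V`: the coefficient at `(l, j)` is
`Σ_x g_{(j,x)} x(k^*_l)`. -/
theorem sum_smul_eigenVec_eq [Fintype J] (k : Module.Basis ι F₀ K) (ω : Module.Basis J K V)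
    (g : J × (K ≃ₐ[F₀] K) → K) :
    ∑ p, g p • ∑ l, p.2 (k.traceDual l) ⊗ₜ[F₀] (k l • ω p.1) =
      ∑ q : ι × J, (∑ x : K ≃ₐ[F₀] K, g (q.2, x) * x (k.traceDual q.1)) •
        (Algebra.TensorProduct.basis K (k.smulTower ω) : Module.Basis (ι × J) K (K ⊗[F₀] V)) q := by
  simp only [Algebra.TensorProduct.basis_apply, Module.Basis.smulTower_apply, Finset.smul_sum, Finset.sum_smul,
    Fintype.sum_prod_type, TensorProduct.smul_tmul', smul_eq_mul, mul_one]
  conv_lhs => arg 2; ext j; rw [Finset.sum_comm]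
  rw [Finset.sum_comm]

/-- The eigenvectors `e (j, x) = Σ_l x(k^*_l) ⊗ (k_l • ω_j)`, `(j, x) ∈ J × Gal(K/F₀)`, are `K`-linearly independent
(Dedekind's independence of characters, applied in each `j`-slot). -/
theorem linearIndependent_eigenVec [Fintype J] (k : Module.Basis ι F₀ K) (ω : Module.Basis J K V) :
    LinearIndependent K (fun p : J × (K ≃ₐ[F₀] K) => ∑ l, p.2 (k.traceDual l) ⊗ₜ[F₀] (k l • ω p.1)) := by
  classical
  rw [Fintype.linearIndependent_iff]
  intro g hg p
  rw [sum_smul_eigenVec_eq] at hg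
  -- all coefficients vanish
  have hcoef : ∀ (l : ι) (j : J), ∑ x : K ≃ₐ[F₀] K, g (j, x) * x (k.traceDual l) = 0 := by
    intro l j
    have h1 := congrArg
      (fun w => (Algebra.TensorProduct.basis K (k.smulTower ω) : Module.Basis (ι × J) K (K ⊗[F₀] V)).repr w (l, j)) hg
    simp only [Module.Basis.repr_sum_self, map_zero, Finsupp.zero_apply] at h1
    exact h1
  -- hence `Σ_x g_{(j,x)} • x = 0` as a function on `K` (evaluate on the basis `k^*`)
  have hfun : ∑ x : K ≃ₐ[F₀] K, g (p.1, x) • (x : K → K) = 0 := by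
    funext a
    conv_lhs => rw [← k.traceDual.sum_repr a]
    simp only [Finset.sum_apply, Pi.smul_apply, map_sum, map_smul, smul_eq_mul, Finset.mul_sum, Pi.zero_apply]
    rw [Finset.sum_comm]
    refine Finset.sum_eq_zero fun l _ => ?_
    have := hcoef l p.1
    calc ∑ x : K ≃ₐ[F₀] K, g (p.1, x) * (k.traceDual.repr a l • x (k.traceDual l))
        = k.traceDual.repr a l • ∑ x : K ≃ₐ[F₀] K, g (p.1, x) * x (k.traceDual l) := by
          rw [Finset.smul_sum]
          refine Finset.sum_congr rfl fun x _ => ?_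
          exact mul_smul_comm _ _ _
      _ = 0 := by rw [this, smul_zero]
  have hli : ∀ c : (K ≃ₐ[F₀] K) → K, ∑ x, c x • (x : K → K) = 0 → ∀ x, c x = 0 :=
    Fintype.linearIndependent_iff.mp (linearIndependent_algEquiv_coe (F₀ := F₀) (K := K))
  exact hli (fun x => g (p.1, x)) hfun p.2

variable [IsGalois F₀ K]

omit [DecidableEq ι] [Algebra.IsSeparable F₀ K] in
/-- Counting: `|J × Gal(K/F₀)| = |J| · [K : F₀] = finrank_K (K ⊗[F₀] V)`. -/
theorem card_prod_algEquiv_eq_finrank [Fintype J] (k : Module.Basis ι F₀ K) (ω : Module.Basis J K V) :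
    Fintype.card (J × (K ≃ₐ[F₀] K)) = Module.finrank K (K ⊗[F₀] V) := by
  rw [Module.finrank_eq_card_basis
      (Algebra.TensorProduct.basis K (k.smulTower ω) : Module.Basis (ι × J) K (K ⊗[F₀] V)),
    Fintype.card_prod, Fintype.card_prod, mul_comm]
  congr 1
  have h := IsGalois.card_aut_eq_finrank F₀ K
  rw [Module.finrank_eq_card_basis k] at h
  rw [← h]
  exact Fintype.card_eq_nat_card

/-- **The Galois-equivariant eigenbasis** (LEMMA-R-RESIDUE.md §5, «`e_{(j,x)} := (ε_x ⊗ 1)(ω_j)`»): for a finite Galois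
extension `K/F₀` and a `K`-vector space `V` with finite `K`-basis `ω`, `K ⊗[F₀] V` has a `K`-basis `e` indexed by
`J × Gal(K/F₀)` such that `(σ ⊗ 1) e (j, x) = e (j, σ * x)` and `(1 ⊗ b) e (j, x) = x(b) • e (j, x)` — `e (j, x)` spans the
`x`-eigenline of the `j`-th summand and the Galois group permutes the basis through its action on the second index. -/
theorem exists_equivariant_eigenbasis [Fintype J] (ω : Module.Basis J K V) :
    ∃ e : Module.Basis (J × (K ≃ₐ[F₀] K)) K (K ⊗[F₀] V),
      (∀ (σ x : K ≃ₐ[F₀] K) (j : J), LinearMap.rTensor V σ.toLinearMap (e (j, x)) = e (j, σ * x)) ∧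
      (∀ (x : K ≃ₐ[F₀] K) (j : J) (b : K),
        LinearMap.lTensor K ((LinearMap.lsmul K V b).restrictScalars F₀) (e (j, x)) = x b • e (j, x)) := by
  classical
  let k := Module.finBasis F₀ K
  haveI : FiniteDimensional K (K ⊗[F₀] V) :=
    Module.Finite.of_basis (Algebra.TensorProduct.basis K (k.smulTower ω) : Module.Basis (_ × J) K (K ⊗[F₀] V))
  refine ⟨basisOfLinearIndependentOfCardEqFinrank' _ (linearIndependent_eigenVec k ω)
    (card_prod_algEquiv_eq_finrank k ω), ?_, ?_⟩
  · intro σ x j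
    simp only [coe_basisOfLinearIndependentOfCardEqFinrank']
    exact rTensor_eigenVec k ω σ x j
  · intro x j b
    simp only [coe_basisOfLinearIndependentOfCardEqFinrank']
    exact lTensor_lsmul_eigenVec k ω x j b

/-- The Galois ORBIT SUM of the eigenbasis in the `j`-th slot is the rational generator: `Σ_x e (j, x) = 1 ⊗ ω_j`
(the trace of the dual basis expands `1 = Σ_l Tr(k^*_l) k_l`) — the instance of `Tier3OrbitDescent`'s
`exists_rational_orbit_sum` at the `H¹` level, with the rational vector named explicitly. -/
theorem sum_eigenVec_eq_tmul (k : Module.Basis ι F₀ K) (ω : J → V) (j : J) :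
    ∑ x : K ≃ₐ[F₀] K, ∑ l, x (k.traceDual l) ⊗ₜ[F₀] (k l • ω j) = (1 : K) ⊗ₜ[F₀] ω j := by
  rw [Finset.sum_comm]
  simp only [← TensorProduct.sum_tmul, ← trace_eq_sum_automorphisms, Algebra.algebraMap_eq_smul_one,
    TensorProduct.smul_tmul, ← TensorProduct.tmul_sum, ← smul_assoc]
  congr 1
  have h1 : (1 : K) = ∑ l, Algebra.trace F₀ K (k.traceDual l) • k l := by
    conv_lhs => rw [← k.sum_repr 1]
    refine Finset.sum_congr rfl fun l _ => ?_
    rw [basis_repr_eq_trace_mul_traceDual, one_mul]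
  conv_rhs => rw [← one_smul K (ω j), h1, Finset.sum_smul]

end HodgeRepro.Tier3
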